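import Literature.Computability.AlgebraicComplexity.ChowPointTableauCertificates
import Literature.Computability.AlgebraicComplexity.TableauEvalLabelMajorImpl
import Literature.Computability.AlgebraicComplexity.TableauEvalSparseEntryImpl
import HarnessLib

/-!
# Tableau certificates at CHOW points by the LABEL-MAJOR programme: a content-table trie, and the
# table-certificate theorems for `mult_λ(ℂ[Ch_N^m]_d)`

Glue file (cell `val-lit`, DIP20 lane; honest framing below), companion of
`ExplicitPointTableauCertificates.lean` and `ChowPointTableauCertificates.lean` (val-lit-p6: the
evaluation-rank principle for the multiplicity `coordRingMultiplicity K Z m χ` of a type in the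
coordinate ring of a SET `Z` of forms; power-sum points; the COLUMN-major coefficient-leaf evaluator
`evalCProd` at Chow points `ℓ_1 ⋯ ℓ_m ∈ Ch_N^m = chowSet K N m`, enough for shapes with few tall
columns such as `(34,6,2)`). The positivity certificates of DIP Prop. 5.1 live on shapes whose columns
are almost all of full height (`(10,10,10)`, `(17,17,14)`, …: `6^{10}`–`6^{14}` column-bijection tuples),
which only the LABEL-major dynamic programme reaches. DIP §5
(arXiv:1901.04576 pp. 12–13, proof of Prop. 5.1 = "Proposition 18"): "the statement
`dim HWV_λ(ℂ[Ch_m^n]_d) > 0` is equivalent to the existence of a `π ∈ 𝔖_{dn}` and a `p ∈ Ch_m^n` such that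
[the contraction (5.5)] is nonzero … We choose a random `p = ℓ_1 ⋯ ℓ_n`"; §6 (p. 15) evaluates 8
tableau functions at points to certify a multiplicity VALUE by the rank of the evaluation matrix.

A Chow point is, for the tree's evaluator, the one-term sum-of-products presentation
`chowPoint rows = ⟨[(1, rows)]⟩` (`rows` = the `m` integer linear forms). The label-major programme
`evalA` (`TableauEvalLabelMajor.lean`: DIP §5's transfer-matrix organisation, state = unused alternator
variables per column, labels processed in order) reads the point only through a trie of the
symmetric-tensor entries `symEntry P w` at all `V^m` words — at a one-term point a PERMANENT of an
`m × m` matrix per word (`720 · 3^6`, `5040 · 4^7` products: beyond one kernel evaluation for `m = 7`).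
By the tree's polarisation identity `symEntry_eq_S` the entry depends on the word only through its
CONTENT (`symEntry P w = α(w)! · coeff_{α(w)}` of the presented form; p6's coefficient leaf
`symEntryProd`, `symEntry_eq_symEntryProd`). This file therefore
* §1 ships the entries as a CONTENT TABLE `tab : List (List ℕ × R)` (one value per count vector; absent
  = `0`), checked ONCE per point against the coefficient leaf at the canonical word of every content
  (`checkTable`: `(m+V-1 choose V-1)` cheap leaves), builds the word trie of the label-major programme
  from the table (`tableTrie`, `find_tableTrie`) and runs the programme (`evalT`);
  **`evalT_eq_evalC`**: for a column-strict network passing `Network.check` and a table passing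
  `checkTable` at `(V, m) = (varBound, perLabel)`, `evalT tab Nw = evalC P Nw` (the tree's
  trie-parametric correctness chain `layerSum_layersA` / `specL_eq_evalC` of
  `TableauEvalLabelMajorImpl/Spec.lean`, fed with the find lemma and the content invariance). Kernel cost
  ≈ number of DP transitions (measured ≈ 1.4 ms each), which SPARSE points (most `ℓ_s` coordinate forms)
  keep small — the pub-gct device of `PerDetHwvCertificateNineNine.lean`;
* §2 `chowPoint` (membership in `chowSet` is p6's `splfPoly_oneTerm_mem_chowSet`);
* §3 **`le_coordRingMultiplicity_chowSet_of_tableCertificate`** — the LIST form a certificate file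
  instantiates: networks (shape `λ`, canonical alternators, column-strict, common variable bound `V`),
  integer Chow points, their content tables (one `checkTable` kernel lemma per point), the table of `evalT`
  values (one kernel lemma per entry) and a right inverse of that table modulo `p` give
  `r ≤ mult_{λ^*} K[Ch_N^m]` (`le_coordRingMultiplicity_of_certificate`, p6); and the one-entry form
  **`coordRingMultiplicity_chowSet_pos_of_tableCertificate`** (`r = 1`: one nonzero value — DIP
  Prop. 5.1's format).

Definitions here are evaluator/data plumbing only (no statement of record is touched, no named fact).
HONEST FRAMING: certificate-checking plumbing for DIP's TOY MODEL `Pow ⊄ Ch`; nothing here bears on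
permanent versus determinant; VP ≠ VNP is not proved.

## References
* [DorflerIkenmeyerPanova2020] J. Dörfler, C. Ikenmeyer, G. Panova, *On geometric complexity theory:
  multiplicity obstructions are stronger than occurrence obstructions*, SIAM J. Appl. Algebra Geom. 4
  (2020) = arXiv:1901.04576, §5 (proof of Prop. 5.1, eqs. (5.5)–(5.6), arXiv pp. 12–13), §6 (p. 15).
* [BurgisserIkenmeyer2013] P. Bürgisser, C. Ikenmeyer, *Explicit lower bounds via geometric complexity
  theory*, STOC 2013, §4.

## Mathlib and tree
Mathlib: `List.perm_iff_count`, `List.Perm.sum_eq`, `List.count_replicate`, `List.sum_map_eq_nsmul_single`.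
Tree: `symEntry`, `Point`, `Network`, `evalC` (`PlethysmTableauEvaluation`); `PTrie`, `layersA`,
`layerSum`, `Network.varBound`, `Network.initLayer` (`TableauEvalLabelMajor`); `PTrie.find_cons`,
`PTrie.find_empty`, `PTrie.isEmpty_iff`, `layerSum_layersA`, `pairwise_of_columnStrict`, `resid_zero`,
`layerSpec`, `finEnum`, `lt_varBound` (`TableauEvalLabelMajorImpl`); `specL_eq_evalC`
(`TableauEvalLabelMajorSpec`); `symEntry_eq_S`, `Sfun`, `contentL`, `coefM`, `formM` (`TableauEvalBridge`);
`Network.spec_of_check` (`PerDetHwvCertificateSemantics`); `le_coordRingMultiplicity_of_certificate`,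
`finRevEnum`, `Network.canonicalVars` (`ExplicitPointTableauCertificates`, p6); `symEntryProd`,
`symEntry_eq_symEntryProd`, `splfPoly_oneTerm_mem_chowSet` (`ChowPointTableauCertificates`, p6);
`chowSet`, `coordRingMultiplicity` (`DIP20MultiplicityObstructions`, t07).

Provenance: val-lit cell, literature-prover val-lit-t15 g4 (DIP20 Prop. 5.1 / Thm. 2.3 (2)(a) Chow-side
certificates).
-/

namespace Literature.Computability.AlgebraicComplexity

namespace TableauEval

open MvPolynomial
open _root_.Literature.NumberTheory.DiophantineGeometry

/-! ## §1 Content tables, the table trie, and the table-driven label-major evaluator -/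

section Table

variable {R : Type*} [CommRing R] [DecidableEq R]

/-- The count vector of a word on the letters `0, …, V-1`: `[#0, #1, …, #(V-1)]`. [folklore] -/
def counts (V : ℕ) (w : List ℕ) : List ℕ := (List.range V).map fun v => w.count v

/-- The canonical word of a count vector: `0^{c_0} 1^{c_1} ⋯ (V-1)^{c_{V-1}}`. [folklore] -/
def repWord (V : ℕ) (cnt : List ℕ) : List ℕ :=
  (List.range V).flatMap fun v => List.replicate (cnt.getD v 0) v

/-- Lookup in a content table (an association list from count vectors to values; absent = `0`).
[folklore] -/
def lookupC (tab : List (List ℕ × R)) (cnt : List ℕ) : R :=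
  match tab.find? (fun e => e.1 == cnt) with
  | some e => e.2
  | none => 0

/-- All count vectors of length `V` with sum `m` (the contents of the words of length `m`).
[folklore] -/
def allCounts : ℕ → ℕ → List (List ℕ)
  | 0, m => if m = 0 then [[]] else []
  | V + 1, m => (List.range (m + 1)).flatMap fun c => (allCounts V (m - c)).map (c :: ·)

/-- **The table check**: at the canonical word of every content of length-`m` words on `V` letters,
the table holds the symmetric-tensor entry of the point, computed by p6's coefficient leaf
`symEntryProd` (`= symEntry`, `symEntry_eq_symEntryProd`). [folklore] -/
def checkTable (P : Point R) (V m : ℕ) (tab : List (List ℕ × R)) : Bool :=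
  (allCounts V m).all fun cnt => decide (lookupC tab cnt = symEntryProd V P (repWord V cnt))

/-- The word trie of the label-major programme built from a content table: the leaf below the word
`pre ++ w` is the table value at the content of `pre ++ w` (pruned like `buildPTrie`). [folklore] -/
def tableTrie (V : ℕ) (tab : List (List ℕ × R)) : ℕ → List ℕ → PTrie R
  | 0, pre => PTrie.mkLeaf (lookupC tab (counts V pre))
  | k + 1, pre => PTrie.mkNode ((List.range V).map fun i => tableTrie V tab k (pre ++ [i]))

/-- **Table-driven label-major evaluation** of a tableau network: `evalA` with the table trie in
place of the trie of permanents. [folklore] -/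
def evalT (tab : List (List ℕ × R)) (Nw : Network) : R :=
  layerSum (layersA Nw.cols Nw.varBound (tableTrie Nw.varBound tab Nw.perLabel [])
    (List.range Nw.nlabels) Nw.initLayer)

/-- The table trie holds the table values at contents: for a word `w` of length `k` with letters
`< V`, `find w (tableTrie V tab k pre) = lookupC tab (counts V (pre ++ w))`. [folklore] -/
private theorem find_tableTrie (V : ℕ) (tab : List (List ℕ × R)) : ∀ (k : ℕ) (pre w : List ℕ),
    w.length = k → (∀ v ∈ w, v < V) →
      (tableTrie V tab k pre).find w = lookupC tab (counts V (pre ++ w))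
  | 0, pre, w, hw, _ => by
    rw [List.length_eq_zero_iff] at hw; subst hw
    simp only [tableTrie, PTrie.mkLeaf, List.append_nil]
    split_ifs with h
    · rw [PTrie.find_empty, h]
    · rfl
  | k + 1, pre, [], hw, _ => by simp at hw
  | k + 1, pre, v :: w, hw, hv => by
    have hvV : v < V := hv v List.mem_cons_self
    have hw' : w.length = k := by simpa using hw
    have IH := find_tableTrie V tab k (pre ++ [v]) w hw' (fun x hx => hv x (List.mem_cons_of_mem _ hx))
    rw [List.append_assoc, List.singleton_append] at IH
    simp only [tableTrie, PTrie.mkNode]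
    split_ifs with h
    · rw [PTrie.find_empty, ← IH]
      have hmem : tableTrie V tab k (pre ++ [v]) ∈
          (List.range V).map fun i => tableTrie V tab k (pre ++ [i]) :=
        List.mem_map.mpr ⟨v, List.mem_range.mpr hvV, rfl⟩
      have he := (List.all_eq_true.mp h) _ hmem
      rw [(PTrie.isEmpty_iff _).mp he, PTrie.find_empty]
    · rw [PTrie.find_cons, PTrie.child, List.getD_eq_getElem _ _ (by simpa using hvV)]
      simp only [List.getElem_map, List.getElem_range]
      exact IH

omit [CommRing R] [DecidableEq R] in
/-- Count vectors of length `V` and sum `m` are listed by `allCounts V m`. [folklore] -/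
private theorem mem_allCounts : ∀ (V m : ℕ) (cnt : List ℕ), cnt.length = V → cnt.sum = m →
    cnt ∈ allCounts V m
  | 0, m, cnt, hl, hs => by
    rw [List.length_eq_zero_iff] at hl; subst hl
    simp only [List.sum_nil] at hs; subst hs
    simp [allCounts]
  | V + 1, m, [], hl, _ => by simp at hl
  | V + 1, m, c :: cs, hl, hs => by
    simp only [List.length_cons, Nat.add_right_cancel_iff] at hl
    simp only [List.sum_cons] at hs
    simp only [allCounts, List.mem_flatMap, List.mem_range, List.mem_map, List.cons.injEq]
    exact ⟨c, by omega, cs, mem_allCounts V (m - c) cs hl (by omega), rfl, rfl⟩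

omit [CommRing R] [DecidableEq R] in
/-- `counts V w` has length `V`. [folklore] -/
private theorem length_counts (V : ℕ) (w : List ℕ) : (counts V w).length = V := by
  simp [counts]

omit [CommRing R] [DecidableEq R] in
/-- The entry of `counts`. [folklore] -/
private theorem getD_counts (V : ℕ) (w : List ℕ) (a : ℕ) (ha : a < V) : (counts V w).getD a 0 = w.count a := by
  rw [counts, List.getD_eq_getElem _ _ (by simpa using ha)]
  simp

omit [CommRing R] [DecidableEq R] in
/-- The counts of a word with letters `< V` sum to its length. [folklore] -/
private theorem sum_counts (V : ℕ) : ∀ (w : List ℕ), (∀ v ∈ w, v < V) → (counts V w).sum = w.length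
  | [], _ => by simp [counts]
  | a :: w, h => by
    have ha : a < V := h a List.mem_cons_self
    have IH := sum_counts V w fun v hv => h v (List.mem_cons_of_mem _ hv)
    unfold counts at IH ⊢
    have h1 : ((List.range V).map fun v => (a :: w).count v) =
        (List.range V).map fun v => w.count v + (if v = a then 1 else 0) := by
      refine List.map_congr_left fun v _ => ?_
      rw [List.count_cons]
      by_cases hva : v = a
      · subst hva; simp
      · simp [hva, Ne.symm hva]
    rw [h1, List.sum_map_add, IH, List.length_cons]
    congr 1
    rw [List.sum_map_eq_nsmul_single a]
    · rw [List.count_eq_one_of_mem List.nodup_range (List.mem_range.mpr ha)]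
      simp
    · intro v hva _
      simp [hva]

omit [CommRing R] [DecidableEq R] in
/-- Letters of the canonical word are `< V`. [folklore] -/
private theorem lt_of_mem_repWord (V : ℕ) (cnt : List ℕ) (v : ℕ) (hv : v ∈ repWord V cnt) : v < V := by
  simp only [repWord, List.mem_flatMap, List.mem_range, List.mem_replicate] at hv
  obtain ⟨a, ha, -, rfl⟩ := hv
  exact ha

omit [CommRing R] [DecidableEq R] in
/-- Letter counts of the canonical word. [folklore] -/
private theorem count_repWord (V : ℕ) (cnt : List ℕ) (a : ℕ) :
    (repWord V cnt).count a = if a < V then cnt.getD a 0 else 0 := by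
  rw [repWord, List.count_flatMap]
  split_ifs with ha
  · rw [List.sum_map_eq_nsmul_single a]
    · rw [List.count_eq_one_of_mem List.nodup_range (List.mem_range.mpr ha)]
      simp
    · intro v hva _
      simp [Function.comp_apply, List.count_replicate, hva]
  · apply List.sum_eq_zero
    intro x hx
    simp only [List.mem_map, List.mem_range, Function.comp_apply] at hx
    obtain ⟨v, hv, rfl⟩ := hx
    rw [List.count_replicate]
    have : v ≠ a := fun h => ha (h ▸ hv)
    simp [this]

omit [CommRing R] [DecidableEq R] in
/-- **A word with letters `< V` is a permutation of the canonical word of its content.** [folklore] -/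
private theorem perm_repWord_counts (V : ℕ) (w : List ℕ) (hw : ∀ v ∈ w, v < V) :
    w.Perm (repWord V (counts V w)) := by
  rw [List.perm_iff_count]
  intro a
  rw [count_repWord]
  split_ifs with ha
  · rw [getD_counts V w a ha]
  · exact List.count_eq_zero.mpr fun h => ha (hw a h)

variable {σ : Type*} {Nv : ℕ} (E : Enum σ Nv) in
omit [CommRing R] [DecidableEq R] in
/-- The content `contentL` is invariant under permutations of the word. [folklore] -/
private theorem contentL_perm {w w' : List ℕ} (h : w.Perm w') : contentL E w = contentL E w' := by
  unfold contentL
  exact (h.map _).sum_eq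

/-- **The table check is sound**: at every word of length `m` with letters `< V`, the table value at its
content is the symmetric-tensor entry of the point (content invariance of `symEntry` by the tree's
polarisation identity `symEntry_eq_S`: DIP's contraction (5.6) reads the point only through the
coefficients of `p`). [cite: DorflerIkenmeyerPanova2020, §5 eq. (5.6) (arXiv p. 13)] -/
theorem lookupC_counts_eq_symEntry (P : Point R) {V m : ℕ} (hV : 0 < V) (tab : List (List ℕ × R))
    (htab : checkTable P V m tab = true)
    (hP : ∀ t : Fin P.terms.length, (P.terms.get t).2.length = m)
    (w : List ℕ) (hw : w.length = m) (hv : ∀ v ∈ w, v < V) :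
    lookupC tab (counts V w) = symEntry P w := by
  have hmem : counts V w ∈ allCounts V m :=
    mem_allCounts V m _ (length_counts V w) (by rw [sum_counts V w hv, hw])
  have hchk := (List.all_eq_true.mp htab) _ hmem
  rw [decide_eq_true_eq] at hchk
  -- both words have the same content
  have hperm := perm_repWord_counts V w hv
  let E := finEnum V hV
  haveI : NeZero V := ⟨hV.ne'⟩
  have hlen' : (repWord V (counts V w)).length = m := by rw [← hperm.length_eq, hw]
  rw [hchk, ← symEntry_eq_symEntryProd P hP _ hlen' (fun v h => lt_of_mem_repWord V _ v h),
    symEntry_eq_S E P hP _ hlen' (fun v h => lt_of_mem_repWord V _ v h),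
    symEntry_eq_S E P hP w hw hv, contentL_perm E hperm]

/-- **The table-driven programme computes the column-major evaluator**: for a list point all of whose
terms have `m` forms, a column-strict network passing its structural check, and a content table passing
`checkTable` at `(V, m) = (Nw.varBound, Nw.perLabel)`, `evalT tab Nw = evalC P Nw`.
[cite: DorflerIkenmeyerPanova2020, §5 eq. (5.6) (arXiv p. 13)] -/
theorem evalT_eq_evalC (P : Point R) (Nw : Network) (tab : List (List ℕ × R))
    (hP : ∀ t : Fin P.terms.length, (P.terms.get t).2.length = Nw.perLabel)
    (hN : Nw.check = true) (hcs : Nw.columnStrict = true)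
    (htab : checkTable P Nw.varBound Nw.perLabel tab = true) : evalT tab Nw = evalC P Nw := by
  obtain ⟨hlen, hlab, hcnt⟩ := Network.spec_of_check Nw hN
  have hV : 0 < Nw.varBound := Nat.succ_pos _
  let E := finEnum Nw.varBound hV
  set T := tableTrie Nw.varBound tab Nw.perLabel [] with hT
  have h1 : evalT tab Nw = specL (fun w => T.find w) (List.range Nw.nlabels) Nw.cols := by
    unfold evalT
    rw [← hT, List.range_eq_range', layerSum_layersA Nw.varBound T Nw.cols
      (pairwise_of_columnStrict Nw hcs) Nw.nlabels 0 _
      (fun e he => by simp [Network.initLayer] at he; subst he; simp)]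
    simp [layerSpec, Network.initLayer, resid_zero]
  rw [h1]
  refine specL_eq_evalC E P Nw hP hlen (fun c hc v hv => lt_varBound Nw c hc v hv) hlab hcnt hcs _
    fun w hw hv => ?_
  show T.find w = Sfun E P Nw.perLabel (contentL E w)
  rw [hT, find_tableTrie Nw.varBound tab Nw.perLabel [] w hw hv, List.nil_append,
    lookupC_counts_eq_symEntry P hV tab htab hP w hw hv, symEntry_eq_S E P hP w hw hv]

end Table

/-! ## §2 Chow points: one product of integer linear forms -/

section ChowPoint

/-- **A Chow point** for the evaluator: the one-term presentation `1 · ℓ_0 ⋯ ℓ_{m-1}` of a product of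
`m` linear forms (each the list of its coefficients on the certificate variables `0, 1, …`).
[cite: DorflerIkenmeyerPanova2020, §5 ("We choose a random `p ∈ Ch_m^n`, i.e., `p = ℓ_1 ⋯ ℓ_n`", arXiv p. 12)] -/
def chowPoint {R : Type*} [CommRing R] (rows : List (List R)) : Point R := ⟨[(1, rows)]⟩

/-- `chowPoint` commutes with ring maps. [folklore] -/
private theorem chowPoint_map {R S : Type*} [CommRing R] [CommRing S] (f : R →+* S) (rows : List (List R)) :
    (chowPoint rows).map f = chowPoint (rows.map fun ℓ => ℓ.map f) := by
  simp [chowPoint, Point.map]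

end ChowPoint

/-! ## §3 The certificate theorems for Chow points (list form) -/

section ListForm

variable {N : ℕ} [NeZero N]

/-- Reduction modulo `p` detects nonsingularity of an integer matrix. [folklore] -/
private theorem det_ne_zero_of_map_zmod' {r : ℕ} (p : ℕ) (M : Matrix (Fin r) (Fin r) ℤ)
    (h : ((Int.castRingHom (ZMod p)).mapMatrix M).det ≠ 0) : M.det ≠ 0 := by
  intro h0
  apply h
  rw [← RingHom.map_det, h0, map_zero]

/-- A square matrix with a right inverse over a nontrivial commutative ring has nonzero determinant.
[folklore] -/
private theorem det_ne_zero_of_mul_eq_one' {R : Type*} [CommRing R] [Nontrivial R] {r : ℕ}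
    {M B : Matrix (Fin r) (Fin r) R} (h : M * B = 1) : M.det ≠ 0 := by
  intro h0
  have h1 := congrArg Matrix.det h
  rw [Matrix.det_mul, h0, zero_mul, Matrix.det_one] at h1
  exact zero_ne_one h1

/-- **Certificate theorem, list form, Chow points.** A certificate file supplies: the networks `netsL`
(shape `lamL` = sorted parts of `lam`, canonical alternators, `d` labels, `m` boxes per label, column-strict,
all with the same variable bound `V`), the integer Chow points `ptsL` (each `m` forms, the form
`∏_s ℓ_s ∈ Ch_N^m`), one content table per point passing `checkTable` (one kernel lemma per point), the
table `vals` of the table-driven evaluator's INTEGER values (one kernel lemma per entry), and a right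
inverse `B` of that table modulo `p`; conclusion `r ≤ mult_{λ^*} K[Ch_N^m]` (`coordRingMultiplicity` of
`chowSet K N m`). [cite: DorflerIkenmeyerPanova2020, §5–§6 (arXiv pp. 12–15)] -/
theorem le_coordRingMultiplicity_chowSet_of_tableCertificate (K : Type) [Field K] [CharZero K]
    {m d V e r : ℕ} (hm : m ≠ 0) (lam : Nat.Partition e) (lamL : List ℕ)
    (hlamL : lam.sortedParts = lamL) (hlen : lamL.length ≤ N)
    (netsL : List Network) (ptsL : List (List (List ℤ))) (tabsL : List (List (List ℕ × ℤ)))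
    (hr1 : netsL.length = r) (hr2 : ptsL.length = r)
    (hnets : ∀ Nw ∈ netsL, Nw.check = true ∧ Nw.canonicalVars = true ∧ Nw.columnStrict = true ∧
      Nw.nlabels = d ∧ Nw.perLabel = m ∧ Nw.varBound = V ∧ Nw.shape = lamL)
    (hptsL : ∀ L ∈ ptsL, L.length = m)
    (htabs : ∀ b : ℕ, b < r → checkTable (chowPoint (ptsL.getD b [])) V m (tabsL.getD b []) = true)
    (vals : List (List ℤ))
    (hvals : ∀ a b : ℕ, a < r → b < r →
      evalT (tabsL.getD b []) (netsL.getD a ⟨0, 0, []⟩) = (vals.getD a []).getD b 0)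
    (p : ℕ) [Fact (1 < p)] (B : Matrix (Fin r) (Fin r) (ZMod p))
    (hB : (Int.castRingHom (ZMod p)).mapMatrix (Matrix.of fun a b : Fin r => (vals.getD a []).getD b 0)
      * B = 1) :
    r ≤ coordRingMultiplicity K (chowSet K N m) m (Weight.dualOfPartition N lam) := by
  classical
  let nets : Fin r → Network := fun a => netsL.getD a ⟨0, 0, []⟩
  let pts : Fin r → Point ℤ := fun b => chowPoint (ptsL.getD b [])
  have hmemN : ∀ a : Fin r, nets a ∈ netsL := fun a => by
    show netsL.getD a _ ∈ netsL
    rw [List.getD_eq_getElem _ _ (by rw [hr1]; exact a.isLt)]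
    exact List.getElem_mem _
  have hmemP : ∀ b : Fin r, ptsL.getD b [] ∈ ptsL := fun b => by
    rw [List.getD_eq_getElem _ _ (by rw [hr2]; exact b.isLt)]
    exact List.getElem_mem _
  have hpts : ∀ b, ∀ t ∈ (pts b).terms, t.2.length = m := by
    intro b t ht
    simp only [pts, chowPoint, List.mem_singleton] at ht
    subst ht
    exact hptsL _ (hmemP b)
  have hpts' : ∀ b, ∀ t : Fin (pts b).terms.length, ((pts b).terms.get t).2.length = m :=
    fun b t => hpts b _ (List.get_mem _ _)
  -- the points lie in `Ch`
  have hZ : ∀ b, splfPoly (coefM ((pts b).map (Int.castRingHom K)))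
      (formM (finRevEnum N) ((pts b).map (Int.castRingHom K)) m) ∈ chowSet K N m := by
    intro b
    rw [show (pts b).map (Int.castRingHom K) =
        chowPoint ((ptsL.getD b []).map fun ℓ => ℓ.map (Int.castRingHom K)) from chowPoint_map _ _]
    exact splfPoly_oneTerm_mem_chowSet (N := N) K m _ _ rfl
  -- the integer evaluation matrix is the table
  have hM : (Matrix.of fun a b => evalC (pts b) (nets a)) =
      Matrix.of fun a b : Fin r => (vals.getD a []).getD b 0 := by
    ext a b
    obtain ⟨hchk, -, hcs, -, hpl, hvb, -⟩ := hnets _ (hmemN a)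
    rw [Matrix.of_apply, Matrix.of_apply, ← hvals a b a.isLt b.isLt]
    refine (evalT_eq_evalC (pts b) (nets a) _ (fun t => (hpts' b t).trans hpl.symm) hchk hcs ?_).symm
    rw [hvb, hpl]
    exact htabs b b.isLt
  have hdet : (Matrix.of fun a b => evalC (pts b) (nets a)).det ≠ 0 := by
    rw [hM]
    exact det_ne_zero_of_map_zmod' p _ (det_ne_zero_of_mul_eq_one' hB)
  exact le_coordRingMultiplicity_of_certificate K hm lam lamL hlamL hlen nets
    (fun a => (hnets _ (hmemN a)).1) (fun a => (hnets _ (hmemN a)).2.1)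
    (fun a => (hnets _ (hmemN a)).2.2.2.1) (fun a => (hnets _ (hmemN a)).2.2.2.2.1)
    (fun a => (hnets _ (hmemN a)).2.2.2.2.2.2) pts hpts _ hZ hdet

/-- **One-entry form** (`r = 1`, DIP Prop. 5.1's "`mult_μ(ℂ[Ch]) > 0`"): one column-strict network of
shape `λ` with canonical alternators, one integer Chow point of `Ch_N^m` with its checked content table,
and a NONZERO value of the table-driven evaluator give `0 < mult_{λ^*} K[Ch_N^m]`.
[cite: DorflerIkenmeyerPanova2020, Prop. 5.1 and §5 (arXiv p. 12)] -/
theorem coordRingMultiplicity_chowSet_pos_of_tableCertificate (K : Type) [Field K] [CharZero K]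
    {m e : ℕ} (hm : m ≠ 0) (lam : Nat.Partition e) (lamL : List ℕ)
    (hlamL : lam.sortedParts = lamL) (hlen : lamL.length ≤ N)
    (Nw : Network) (rows : List (List ℤ)) (tab : List (List ℕ × ℤ))
    (hnet : Nw.check = true ∧ Nw.canonicalVars = true ∧ Nw.columnStrict = true ∧ Nw.perLabel = m ∧
      Nw.shape = lamL)
    (hrows : rows.length = m) (htab : checkTable (chowPoint rows) Nw.varBound m tab = true)
    (v : ℤ) (hval : evalT tab Nw = v) (hv : v ≠ 0) :
    0 < coordRingMultiplicity K (chowSet K N m) m (Weight.dualOfPartition N lam) := by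
  obtain ⟨hchk, hcan, hcs, hpl, hsh⟩ := hnet
  classical
  let nets : Fin 1 → Network := fun _ => Nw
  let pts : Fin 1 → Point ℤ := fun _ => chowPoint rows
  have hpts : ∀ b, ∀ t ∈ (pts b).terms, t.2.length = m := by
    intro b t ht
    simp only [pts, chowPoint, List.mem_singleton] at ht
    subst ht; exact hrows
  have hZ : ∀ b, splfPoly (coefM ((pts b).map (Int.castRingHom K)))
      (formM (finRevEnum N) ((pts b).map (Int.castRingHom K)) m) ∈ chowSet K N m := by
    intro b
    rw [show (pts b).map (Int.castRingHom K) =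
        chowPoint (rows.map fun ℓ => ℓ.map (Int.castRingHom K)) from chowPoint_map _ _]
    exact splfPoly_oneTerm_mem_chowSet (N := N) K m _ _ rfl
  have hev : evalC (chowPoint rows) Nw = v := by
    rw [← hval]
    refine (evalT_eq_evalC (chowPoint rows) Nw tab (fun t => ?_) hchk hcs (hpl.symm ▸ htab)).symm
    have : ((chowPoint rows).terms.get t) = (1, rows) := by
      have ht := t.isLt
      simp only [chowPoint, List.length_singleton, Nat.lt_one_iff] at ht
      simp [chowPoint, List.get_eq_getElem]
    rw [this, hpl]; exact hrows
  have hdet : (Matrix.of fun a b => evalC (pts b) (nets a)).det ≠ 0 := by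
    rw [Matrix.det_fin_one, Matrix.of_apply]
    show evalC (chowPoint rows) Nw ≠ 0
    rw [hev]; exact hv
  have h1 := le_coordRingMultiplicity_of_certificate K hm lam lamL hlamL hlen nets
    (fun _ => hchk) (fun _ => hcan) (d := Nw.nlabels) (fun _ => rfl) (fun _ => hpl) (fun _ => hsh)
    pts hpts _ hZ hdet
  exact h1

end ListForm

end TableauEval

end Literature.Computability.AlgebraicComplexity

/-! ## §4 (append) Chunking the table-driven programme label by label

For rows whose dynamic programme is too long for one kernel evaluation, a certificate module ships
intermediate LAYERS as literals and checks `layersA … (List.range' k n) Lₖ = Lₖ₊ₙ` chunk by chunk; this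
identity reassembles them into `evalT` (the tree's `layersA_append`, `TableauEvalSparseEntryImpl.lean`). -/

namespace Literature.Computability.AlgebraicComplexity

namespace TableauEval

/-- **`evalT` in chunks**: for `k ≤ d`, `evalT tab Nw` is the layer sum of the programme run on the labels
`k, …, d-1` from the layer reached after the labels `0, …, k-1` (both runs with the same table trie
`tableTrie Nw.varBound tab Nw.perLabel []`). Dörfler–Ikenmeyer–Panova's label-by-label transfer matrix,
split at label `k`. [cite: DorflerIkenmeyerPanova2020, §5 (the dynamic programme, arXiv p. 13)] -/
theorem evalT_eq_layerSum_split {R : Type*} [CommRing R] [DecidableEq R] (tab : List (List ℕ × R))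
    (Nw : Network) (k : ℕ) (hk : k ≤ Nw.nlabels) :
    evalT tab Nw =
      layerSum (layersA Nw.cols Nw.varBound (tableTrie Nw.varBound tab Nw.perLabel [])
        (List.range' k (Nw.nlabels - k))
        (layersA Nw.cols Nw.varBound (tableTrie Nw.varBound tab Nw.perLabel [])
          (List.range' 0 k) Nw.initLayer)) := by
  unfold evalT
  rw [← layersA_append, List.range_eq_range']
  congr 2
  rw [show List.range' k (Nw.nlabels - k) = List.range' (0 + k) (Nw.nlabels - k) by rw [Nat.zero_add],
    List.range'_append_1]
  congr 1
  omega

/-- **Consecutive chunks compose**: running labels `a, …, a+m-1` and then `a+m, …, a+m+n-1` is running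
`a, …, a+m+n-1` (restatement of `layersA_append` on `List.range'` for certificate modules).
[cite: DorflerIkenmeyerPanova2020, §5 (the dynamic programme, arXiv p. 13)] -/
theorem layersA_range'_add {R : Type*} [CommRing R] [DecidableEq R] (cols : List Column) (V : ℕ)
    (T : PTrie R) (a m n : ℕ) (L : List (ℕ × List (List ℕ) × R)) :
    layersA cols V T (List.range' (a + m) n) (layersA cols V T (List.range' a m) L) =
      layersA cols V T (List.range' a (m + n)) L := by
  rw [← layersA_append, List.range'_append_1]

end TableauEval

end Literature.Computability.AlgebraicComplexity
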